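import Mathlib
import Summits.CriticalPhenomena.CardyFormulaZ2.Theorems.CardySelfRefinementDefs
import Summits.CriticalPhenomena.CardyFormulaZ2.Theorems.CardySelfRefinementRussoDriftModel
import Summits.CriticalPhenomena.CardyFormulaZ2.Theorems.CardySelfRefinementTrivialSectorRateStubFourArmAboveOneExplorer
import Summits.CriticalPhenomena.CardyFormulaZ2.Theorems.CardySelfRefinementTrivialSectorRateStubFourArmAboveOneExplorerCentres
import Summits.CriticalPhenomena.CardyFormulaZ2.Theorems.CardySelfRefinementTrivialSectorRateStubFourArmAboveOneExplorerScheme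
import Summits.CriticalPhenomena.CardyFormulaZ2.Theorems.CardySelfRefinementTrivialSectorRateStubFourArmAboveOneReduction
import Summits.CriticalPhenomena.CardyFormulaZ2.Theorems.CardySelfRefinementTrivialSectorRateStubFourArmAboveOneTwoArms
import Summits.CriticalPhenomena.CardyFormulaZ2.Theorems.CardySelfRefinementTrivialSectorRateStubFourArmAboveOneSecondMoment
import Summits.CriticalPhenomena.CardyFormulaZ2.Theorems.CardySelfRefinementTrivialSectorRateStubFourArmAboveOneCircuits
import Summits.CriticalPhenomena.CardyFormulaZ2.Theorems.CardySelfRefinementTrivialSectorRateStubFourArmAboveOneCircuitBits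
import Literature.Probability.Percolation.RevealmentOrthogonality
import Literature.Probability.Percolation.BoundaryExplorerRevealment
import Literature.Probability.Percolation.FourArmGarbanHolds
import Literature.Probability.Percolation.SelfRefinementMeasure
import HarnessLib

/-!
# Stub `stub_fourArmAboveOne` of line `far-field-is-a-quarter-turn` (crux `TrivialSectorRate`,
stmt-CriticalPhenomena-10266), PROVED: four alternating arms decay faster than `1/R` along every
admissible RSW path of the self-refinement model `M_k`, `k = 2, 3`

`FourArmAboveOneAlong k γ`: `∃ ε > 0, C` with `M_k(γ s)(fourArmTwoClustersAt c r R) ≤ C (r/R)^{1+ε}`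
for all `s`, `c`, `1 ≤ r ≤ R`, whenever `PathOK k γ` — Garban's multi-scale four-arm bound
(Schramm–Smirnov 2011, App. B, Lemma B.1; van den Berg–Nolin 2020, Lemma 8) for the DEPENDENT model
`M_k(ρ,c₀)` (the `k` sub-edges of a coarse edge of `kℤ²` read a shared coin through a selector),
uniformly along the parameter path.  The proof is the tree's separation-free rendering of Garban's
two-layer revealment scheme (`FourArmGarbanHolds.lean`: van den Berg–Nolin's cluster count `Z`,
circuit bits with the pivotal hole inside the circuit annulus, the boundary-interface explorer of
`B(R)` as the decision tree), run for `M_k` through its coin product structure: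

* `garbanScheme_along` — **the scheme data `hS` of the percolation-free reduction
  `fourArmAboveOneAlong_of_garbanScheme`** (file `…StubFourArmAboveOneReduction.lean`) for
  `M_k(γ s)`, with constants uniform in `s`: from (M2) `E[Z²] ≤ 3`
  (`exists_integral_numCrossingClusters_sq_le_along`), (M1) thin-annulus circuits (`circuitsAlong`),
  (M4a) the block estimate and the mean-zero bit for ALIGNED blocks (files `…CircuitBits*.lean`),
  (M4b) the explorer identities for aligned blocks — (B.7) orthogonality
  `M_integral_revealedBits_mul_eq_zero`, the separation input at an arbitrary centre
  `M_real_fourArmTwoClustersAt_le_mul_setIntegral` (recentring at a coarse vertex,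
  `M_real_fourArmTwoClustersAt_le_ctr`), the revealment bound
  `M_real_revealed_le_real_openDualArmsAt` — on the ALIGNED grid of blocks: centres `k•u` with
  spacing `2ρ + k` in `B(N - ρ)`, block radius `ρ = k(2h+3) ∈ kℕ`, hole radius `h = m + k + 1`
  (absorbing the recentring), circuit annulus `A_{h+2, ρ-1}` (files `…Explorer*.lean`);
* `stub_fourArmAboveOne` — **the registered stub, by name and signature**: the reduction applied
  to (M3) the two-arm decay `openDualArmsAt_decay_along` and `garbanScheme_along`.

References: O. Schramm, S. Smirnov (app. C. Garban), *On the scaling limits of planar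
percolation*, Ann. Probab. 39 (2011), App. B, Lemma B.1, (B.2)–(B.8); J. van den Berg, P. Nolin,
Progr. Probab. 77 (2020) = arXiv:2008.01606, §4.3 Lemma 8, §5; R. O'Donnell, R. Servedio, SIAM J.
Comput. 37 (2007), Thm. 3.2.

Target file:
`Summits/CriticalPhenomena/CardyFormulaZ2/Theorems/CardySelfRefinementTrivialSectorRateStubFourArmAboveOneExplorerAssembly.lean`.
-/

noncomputable section

namespace Summit.CriticalPhenomena.CardyFormulaZ2.Theorems.CardySelfRefinement.FarField

open scoped Classical
open Set MeasureTheory ProbabilityTheory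
open Literature.Probability.LatticeModels Literature.Probability.Percolation
open Literature.Probability.Percolation.ProbeHistory
open Literature.Probability.Percolation.QuadCrossing
open Summit.CriticalPhenomena.CardyFormulaZ2.Theses.CardySelfRefinement

/-! ### The Garban scheme for `M_k(γ s)`, uniformly along the path -/

-- one long assembly with ~50 integer facts in context: the default heartbeat budget is too small
set_option maxHeartbeats 1600000 in
/-- **The Garban scheme data `hS` for `M_k(γ s)` along an RSW path** (the hypothesis `hS` of
`fourArmAboveOneAlong_of_garbanScheme`, verbatim): from (M2) the crossing-cluster second moment
`E[Z²] ≤ 3` (`exists_integral_numCrossingClusters_sq_le_along`, ratio `K₀`, threshold `N₀`) and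
(M1) the thin-annulus circuits (`circuitsAlong` at aspect ratio `8`, constant `ρs`, threshold
`a₀`), at every `s`, every centre `c` and all scales `m ≥ max a₀ 1`, `n ≥ 200 (K₀+1) N₀ m`:
`X = Z/2` for `Z` the number of open clusters of `B(K₀N)` joining `B(N)` to its boundary
(`N = ⌊n/(K₀+1)⌋`), blocks the ALIGNED grid of centres `k•u` with spacing `2ρ + k` in
`B(N - ρ)`, block radius `ρ = k (2h + 3)` with hole radius `h = m + k + 1` and circuit annulus
`A_{h+2, ρ-1}`, bits `ρs · w_j`, revealment by the boundary explorer of `B(K₀N)`, two-arm radii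
`a = ρ + 2`, `b = K₀N - N - 1`; constants `K₁ = 1/(200(K₀+1))²`, `K₂ = 2/ρs`, `K₃ = 1`,
`K₄ = 50 (K₀+1)`.  Fields: orthogonality `M_integral_revealedBits_mul_eq_zero`, separation
`M_real_fourArmTwoClustersAt_le_mul_setIntegral`, revealment `M_real_revealed_le_real_openDualArmsAt`. -/
theorem garbanScheme_along {k : ℕ} (hk : k = 2 ∨ k = 3) {γ : unitInterval → ℝ × ℝ}
    (hγ : PathOK k γ) :
    ∃ (K₁ K₂ K₃ K₄ : ℝ) (C₀ m₀ : ℕ), 0 < K₁ ∧ 0 ≤ K₂ ∧ 0 ≤ K₃ ∧ 0 ≤ K₄ ∧ 1 ≤ C₀ ∧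
      ∀ (s : unitInterval) (c : Site 2) (m n : ℕ), m₀ ≤ m → C₀ * m ≤ n →
        ∃ (J : Finset (Site 2)) (X : BondConfig (Site 2) → ℝ) (C : Site 2 → BondConfig (Site 2) → ℝ)
          (V : Site 2 → Set (BondConfig (Site 2))) (a b : ℕ),
          K₁ * ((n : ℝ) / m) ^ 2 ≤ (J.card : ℝ) ∧
          MemLp X 2 (M k (γ s).1 (γ s).2) ∧
          ∫ ω, X ω ^ 2 ∂(M k (γ s).1 (γ s).2) ≤ 1 ∧
          (∀ j ∈ J, AEStronglyMeasurable (C j) (M k (γ s).1 (γ s).2)) ∧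
          (∀ j ∈ J, ∀ ω, |C j ω| ≤ 1) ∧
          (∀ j ∈ J, MeasurableSet (V j)) ∧
          (∀ i ∈ J, ∀ j ∈ J, i ≠ j →
            ∫ ω, (V i).indicator (C i) ω * (V j).indicator (C j) ω ∂(M k (γ s).1 (γ s).2) = 0) ∧
          (∀ j ∈ J, (M k (γ s).1 (γ s).2).real (fourArmTwoClustersAt c m n) ≤
            K₂ * ∫ ω in V j, X ω * C j ω ∂(M k (γ s).1 (γ s).2)) ∧
          m ≤ a ∧ a ≤ b ∧ (a : ℝ) / b ≤ K₄ * m / n ∧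
          (∀ j ∈ J, ∃ c' : Site 2, (M k (γ s).1 (γ s).2).real (V j) ≤
            K₃ * (M k (γ s).1 (γ s).2).real (openDualArmsAt c' a b)) := by
  have hk0 : 0 < k := by rcases hk with rfl | rfl <;> norm_num
  have hk3 : k ≤ 3 := by rcases hk with rfl | rfl <;> norm_num
  obtain ⟨K₀, N₀, hK₀, hN₀, hZ2⟩ := exists_integral_numCrossingClusters_sq_le_along hk hγ
  obtain ⟨ρs, hρs, a₀, hcirc⟩ := circuitsAlong hk hγ (K := 8) (by norm_num)
  refine ⟨1 / (200 * ((K₀ : ℝ) + 1)) ^ 2, 2 / ρs, 1, 50 * ((K₀ : ℝ) + 1), 200 * (K₀ + 1) * N₀,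
    max a₀ 1, by positivity, by positivity, zero_le_one, by positivity, ?_, fun s c m n hm hmn => ?_⟩
  · calc 1 ≤ N₀ := hN₀
      _ ≤ 200 * (K₀ + 1) * N₀ := Nat.le_mul_of_pos_left N₀ (by positivity)
  have hma₀ : a₀ ≤ m := (le_max_left _ _).trans hm
  have hm1 : 1 ≤ m := (le_max_right _ _).trans hm
  -- scales, as opaque naturals with their defining equations
  obtain ⟨h, hhdef⟩ : ∃ h : ℕ, h = m + k + 1 := ⟨_, rfl⟩
  obtain ⟨a', ha'def⟩ : ∃ a' : ℕ, a' = h + 2 := ⟨_, rfl⟩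
  obtain ⟨ρ, hρdef⟩ : ∃ ρ : ℕ, ρ = k * (2 * h + 3) := ⟨_, rfl⟩
  obtain ⟨b', hb'def⟩ : ∃ b' : ℕ, b' = ρ - 1 := ⟨_, rfl⟩
  obtain ⟨N, hNdef⟩ : ∃ N : ℕ, N = n / (K₀ + 1) := ⟨_, rfl⟩
  obtain ⟨R, hRdef⟩ : ∃ R : ℕ, R = K₀ * N := ⟨_, rfl⟩
  obtain ⟨d', hd'def⟩ : ∃ d' : ℕ, d' = 2 * (2 * h + 3) + 1 := ⟨_, rfl⟩
  obtain ⟨d, hddef⟩ : ∃ d : ℕ, d = k * d' := ⟨_, rfl⟩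
  obtain ⟨L, hLdef⟩ : ∃ L : ℕ, L = (N - ρ) / d := ⟨_, rfl⟩
  obtain ⟨n₄, hn₄def⟩ : ∃ n₄ : ℕ, n₄ = n - k := ⟨_, rfl⟩
  -- integer bookkeeping
  have hK1 : 0 < K₀ + 1 := by omega
  have hNn : (K₀ + 1) * N ≤ n := by rw [hNdef, mul_comm]; exact Nat.div_mul_le_self n (K₀ + 1)
  have hnN : n < (K₀ + 1) * (N + 1) := by
    rw [hNdef, mul_comm]
    have := Nat.lt_div_mul_add (a := n) hK1
    linarith
  have hNlarge : 199 * m ≤ N := le_N_aux hN₀ hmn hnN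
  have hbig : 200 * (N₀ * m) ≤ N := by
    rw [hNdef, Nat.le_div_iff_mul_le hK1]
    calc 200 * (N₀ * m) * (K₀ + 1) = 200 * (K₀ + 1) * N₀ * m := by ring
      _ ≤ n := hmn
  have hNN₀ : N₀ ≤ N :=
    le_trans (Nat.le_mul_of_pos_right N₀ hm1) (le_trans (Nat.le_mul_of_pos_left _ (by norm_num)) hbig)
  have hNn' : N ≤ n := le_trans (Nat.le_mul_of_pos_left N hK1) hNn
  have hh1 : 1 ≤ h := by omega
  have hhk : h ≤ 5 * m := by omega
  have hρk : ρ ≤ 3 * (2 * h + 3) := by rw [hρdef]; exact Nat.mul_le_mul_right _ hk3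
  have hρ2 : 2 * (2 * h + 3) ≤ ρ := by
    rw [hρdef]; exact Nat.mul_le_mul_right _ (by omega : 2 ≤ k)
  have hρm : ρ ≤ 39 * m := by omega
  have hd2 : d = 2 * ρ + k := by rw [hddef, hd'def, hρdef]; ring
  have hdm : d ≤ 81 * m := by omega
  have hρb1 : ρ = b' + 1 := by omega
  have hkρ : k ∣ ρ := by rw [hρdef]; exact Dvd.intro _ rfl
  have hkb : k ∣ b' + 1 := by rw [← hρb1]; exact hkρ
  have h2N : 2 * N ≤ R := by rw [hRdef]; exact Nat.mul_le_mul_right _ hK₀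
  have hMNn : R + N ≤ n := by
    rw [hRdef]
    calc K₀ * N + N = (K₀ + 1) * N := by ring
      _ ≤ n := hNn
  have hNR : N < R := by omega
  have hρN : ρ ≤ N := by omega
  have hd1 : 1 ≤ d := by omega
  have hdL : d * L ≤ N - ρ := by rw [hLdef, mul_comm]; exact Nat.div_mul_le_self _ _
  have hLlarge : N - ρ < d * (L + 1) := by
    rw [hLdef, mul_comm]
    have := Nat.lt_div_mul_add (a := N - ρ) (b := d) (by omega)
    linarith
  have hab' : a' < b' := by omega
  have hthin : 2 * b' ≤ 8 * (b' - a') := by omega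
  have ha'a₀ : a₀ ≤ a' := by omega
  have hha : h + 2 ≤ a' := by omega
  have hmh : m + k < h := by omega
  have hkn : k ≤ n := by omega
  have hn₄n : n₄ + k ≤ n := by omega
  have hρb : ρ + 2 ≤ R - N - 1 := by omega
  set μ := M k (γ s).1 (γ s).2 with hμ
  haveI : IsProbabilityMeasure μ := isProbabilityMeasure_M k (γ s).1 (γ s).2
  set J : Finset (Site 2) := gridCentres d L with hJdef
  -- geometry of the centres
  have hJctr : ∀ j ∈ J, ∃ u : Site 2, j = ctr k u := fun j hj => by
    rw [hJdef, hddef] at hj; exact exists_eq_ctr_of_mem_gridCentres hj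
  have hjabs : ∀ j ∈ J, ∀ i, |j i| ≤ (N : ℤ) - ρ := by
    intro j hj i
    have h1 := abs_apply_le_of_mem_gridCentres hj i
    have h2 : (d : ℤ) * L ≤ (N : ℤ) - ρ := by
      have h3 := hdL
      zify [hρN] at h3
      exact h3
    linarith
  have hV : ∀ j ∈ J, ∀ x : Site 2, x - j ∈ box 2 ρ → x ∈ box 2 N := by
    intro j hj x hx
    rw [mem_box] at hx ⊢
    intro i
    have h1 := hx i
    have h2 := hjabs j hj i
    simp only [Pi.sub_apply] at h1
    cases abs_cases (j i) <;> constructor <;> omega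
  have hb : ∀ j ∈ J, ∀ i, (b' : ℤ) + 2 + |j i| ≤ R := by
    intro j hj i
    have h2 := hjabs j hj i
    have hM2 : 2 * (N : ℤ) ≤ R := by exact_mod_cast h2N
    have : (b' : ℤ) + 2 + ρ ≤ N := by
      have : b' + 2 + ρ ≤ N := by omega
      exact_mod_cast this
    linarith
  have hn4 : ∀ j ∈ J, ∀ i, (R : ℤ) + |j i| ≤ n₄ := by
    intro j hj i
    have h2 := hjabs j hj i
    have : (R : ℤ) + N ≤ n₄ + ρ := by
      have : R + N ≤ n₄ + ρ := by omega
      exact_mod_cast this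
    linarith
  have hbrev : ∀ j ∈ J, ∀ i, ((R - N - 1 : ℕ) : ℤ) + 1 + |j i| ≤ R := by
    intro j hj i
    have h2 := hjabs j hj i
    have e1 : ((R - N - 1 : ℕ) : ℤ) = (R : ℤ) - N - 1 := by omega
    rw [e1]
    have hρ0 : (0 : ℤ) ≤ ρ := by positivity
    linarith
  have hhn₄ : h < n₄ := by
    have : R + 0 ≤ n₄ + ρ := by omega
    omega
  -- the circuit probabilities
  have hpO : ∀ j : Site 2, ρs ≤ μ.real (openCircuitInAnnulusAt j a' b') := fun j =>
    (hcirc s j a' b' ha'a₀ hab' hthin).1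
  have hpD : ∀ j : Site 2, ρs ≤ μ.real (dualCircuitInAnnulusAt j a' b') := fun j =>
    (hcirc s j a' b' ha'a₀ hab' hthin).2
  -- the objects
  set Zf : BondConfig (Site 2) → ℝ := fun ω => (numCrossingClusters ω N R : ℝ) with hZf
  set X : BondConfig (Site 2) → ℝ := fun ω => Zf ω / 2 with hX
  set ψ : Site 2 → Finset (Sym2 (Site 2)) → ℝ := fun j o =>
    ρs * circuitWeight j a' b' (μ.real (openCircuitInAnnulusAt j a' b')) (μ.real (dualCircuitInAnnulusAt j a' b')) o
    with hψ
  set C : Site 2 → BondConfig (Site 2) → ℝ := fun j ω => ψ j (obs ω (blockPairs j ρ)) with hC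
  set V : Site 2 → Set (BondConfig (Site 2)) := fun j =>
    {ω | ∃ e ∈ blockPairs j ρ, e ∈ supp ((boundaryExplorer R).hist (termTime R) ω)} with hVdef
  -- measurability and bounds of `X`
  have hZm : Measurable Zf := measurable_numCrossingClusters_real N R
  have hZb : ∀ ω, |Zf ω| ≤ (box 2 N).card := fun ω => by
    simp only [hZf]; rw [Nat.abs_cast]; exact_mod_cast numCrossingClusters_le_card ω N R
  have hXm : Measurable X := hZm.div_const 2
  have hXb : ∀ ω, |X ω| ≤ (box 2 N).card := fun ω => by
    simp only [hX]; rw [abs_div, abs_two]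
    have := hZb ω
    have : (0 : ℝ) ≤ |Zf ω| := abs_nonneg _
    linarith
  -- the fields
  have f_card : 1 / (200 * ((K₀ : ℝ) + 1)) ^ 2 * ((n : ℝ) / m) ^ 2 ≤ (J.card : ℝ) := by
    rw [hJdef, card_gridCentres hd1 L]
    exact card_bound_aux_aligned hN₀ hm1 hmn hnN hρm hdm hLlarge hρN
  have f_memLp : MemLp X 2 μ :=
    MemLp.of_bound hXm.aestronglyMeasurable _ (ae_of_all _ fun ω => by rw [Real.norm_eq_abs]; exact hXb ω)
  have f_sq : ∫ ω, X ω ^ 2 ∂μ ≤ 1 := by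
    have hsq : ∀ ω, X ω ^ 2 = (1 / 4) * Zf ω ^ 2 := fun ω => by simp only [hX]; ring
    simp_rw [hsq]
    rw [integral_const_mul]
    have := hZ2 s N hNN₀
    rw [← hRdef] at this
    simp only [hZf]
    linarith
  have f_meas : ∀ j ∈ J, AEStronglyMeasurable (C j) μ := fun j _ =>
    (measurable_comp_obs (blockPairs j ρ) (ψ j)).aestronglyMeasurable
  have f_abs : ∀ j ∈ J, ∀ ω, |C j ω| ≤ 1 := by
    intro j _ ω
    simp only [hC, hψ]
    rw [abs_mul, abs_of_pos hρs]
    have := abs_circuitWeight_le (j := j) (a' := a') (b' := b') hρs (hpO j) (hpD j) (obs ω (blockPairs j ρ))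
    calc ρs * |circuitWeight j a' b' (μ.real (openCircuitInAnnulusAt j a' b')) (μ.real (dualCircuitInAnnulusAt j a' b'))
          (obs ω (blockPairs j ρ))| ≤ ρs * (1 / ρs) := mul_le_mul_of_nonneg_left this hρs.le
      _ = 1 := by field_simp
  have f_measV : ∀ j ∈ J, MeasurableSet (V j) := fun j _ =>
    (boundaryExplorer R).measurableSet_setOf_hist' (termTime R) fun h => ∃ e ∈ blockPairs j ρ, e ∈ supp h
  have h0 : ∀ j : Site 2, ∫ ω, ψ j (obs ω (blockPairs j ρ)) ∂μ = 0 := by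
    intro j
    simp only [hψ]
    rw [integral_const_mul, hρb1,
      M_integral_circuitWeight_obs k (γ s).1 (γ s).2 rfl (hρs.trans_le (hpO j)) rfl (hρs.trans_le (hpD j)),
      mul_zero]
  have hal : ∀ j ∈ J, ∀ i, (k : ℤ) ∣ j i - ρ ∧ (k : ℤ) ∣ j i + ρ := by
    intro j hj
    obtain ⟨u, rfl⟩ := hJctr j hj
    exact ctr_aligned hkρ u
  have f_orth : ∀ i ∈ J, ∀ j ∈ J, i ≠ j →
      ∫ ω, (V i).indicator (C i) ω * (V j).indicator (C j) ω ∂μ = 0 := by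
    intro i hi j hj hij
    exact M_integral_revealedBits_mul_eq_zero hk0 (γ s).1 (γ s).2 (boundaryExplorer R) (termTime R)
      (hal i hi) (hal j hj) (disjoint_blockPairs_of_mem_gridCentres_of_le (by omega) hi hj hij)
      (ψ i) (ψ j) (h0 i) (h0 j)
  have f_sep : ∀ j ∈ J, μ.real (fourArmTwoClustersAt c m n) ≤ 2 / ρs * ∫ ω in V j, X ω * C j ω ∂μ := by
    intro j hj
    obtain ⟨u, rfl⟩ := hJctr j hj
    have hkey := M_real_fourArmTwoClustersAt_le_mul_setIntegral hk0 (γ s).1 (γ s).2 hNR c u hm1 hmh hhn₄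
      hn₄n hha hab'.le (by rw [← hρb1]; exact hV _ hj) (hb _ hj) (hn4 _ hj) hkb hρs rfl (hpO _) rfl
      (hpD _)
    rw [← hρb1] at hkey
    exact hkey
  have f_ratio : (((ρ + 2 : ℕ)) : ℝ) / ((R - N - 1 : ℕ) : ℝ) ≤ 50 * ((K₀ : ℝ) + 1) * m / n :=
    ratio_bound_aux_aligned hK₀ hN₀ hm1 hmn hnN hRdef (by omega)
  have f_reveal : ∀ j ∈ J, ∃ c' : Site 2, μ.real (V j) ≤ 1 * μ.real (openDualArmsAt c' (ρ + 2) (R - N - 1)) := by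
    intro j hj
    refine ⟨j, ?_⟩
    rw [one_mul]
    exact M_real_revealed_le_real_openDualArmsAt k (γ s).1 (γ s).2 (termTime R) (hbrev j hj)
  refine ⟨J, X, C, V, ρ + 2, R - N - 1, f_card, f_memLp, f_sq, f_meas, f_abs, f_measV, f_orth, f_sep, ?_, hρb,
    f_ratio, f_reveal⟩
  omega

/-- **STUB 3 of the line `far-field-is-a-quarter-turn`, PROVED: four alternating arms decay faster
than `1/R` along every admissible RSW path of the self-refinement model `M_k`, `k = 2, 3`**
(`FourArmAboveOneAlong k γ`; the registered stub `stub_fourArmAboveOne` of the crux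
`TrivialSectorRate`, by name and signature).  Garban's two-layer revealment scheme
(Schramm–Smirnov 2011, App. B, Lemma B.1) with van den Berg–Nolin's cluster count, run for the
dependent model: the percolation-free reduction `fourArmAboveOneAlong_of_garbanScheme`, (M3) the
two-arm decay `openDualArmsAt_decay_along`, and the scheme data `garbanScheme_along` assembled
from (M1) circuits, (M2) `E[Z²] ≤ 3`, (M4a) the aligned-block estimate and (M4b) the explorer
identities for `k`-aligned blocks. -/
theorem stub_fourArmAboveOne :
    ∀ k : ℕ, k = 2 ∨ k = 3 → ∀ γ : unitInterval → ℝ × ℝ, PathOK k γ → FourArmAboveOneAlong k γ :=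
  fun k hk γ hγ =>
    fourArmAboveOneAlong_of_garbanScheme k γ (openDualArmsAt_decay_along hk hγ) (garbanScheme_along hk hγ)

end Summit.CriticalPhenomena.CardyFormulaZ2.Theorems.CardySelfRefinement.FarField

end
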